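import Literature.Geometry.Lorentzian.FinalState
import Literature.Geometry.Lorentzian.Genericity

/-!
# Route PhotonSphereChannels · crux `TameCensorship` (stmt-FinalStateConjecture-17431) · line `Sketch`, skeleton v4 ·
# `stub_robustOfWalls`: finitely many `C¹` walls in general position ⇒ robust escapability

Helper file (`--supports stmt-FinalStateConjecture-17431`) of the reshaped line `Sketch` (lead c1, 2026-08-17): the
sufficient condition through which the robust clause stubs of skeleton v4 (`stub_extremalChartFreeRobust`,
`stub_tameOuterRobust`, and the shared `stub_censorshipRobust`) are meant to be proved — the WALL STRUCTURE of an
exceptional set in every enriched compactly supported probe (the shape of Christodoulou 1999 Thm 4.1 and of the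
Angelopoulos–Kehle–Unger `C¹`-threshold theorem) implies robust (open-dense radial) escapability. Abstract in the
property `Q`; finite-dimensional calculus only; stated without any definition.

References: D. Christodoulou, CQG 16 (1999) A23, p. A24; C. Kehle, R. Unger, arXiv:2402.10190.
-/

set_option linter.dupNamespace false

open Literature.Geometry.Lorentzian
open scoped Manifold ContDiff Topology
open Filter Set Function

noncomputable section

namespace Summit.FinalStateConjecture.FinalStateConjecture.Theorems.PhotonSphereChannels.TameCensorshipUnwind

open Metric

/-- **`stub_robustOfWalls` (line `Sketch`, skeleton v4; sufficient condition for the robust clause stubs, abstract `Q`):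
finitely many `C¹` walls in general position ⇒ robust escapability.** Suppose every compactly supported smooth
admissible probe through `d` enriches (injective linear `L`) so that along EVERY further enrichment `G₂ : ℝᵖ → data`
there are finitely many `C¹` functions `φⱼ : ℝᵖ → ℝ`, each with `φⱼ 0 ≠ 0` or `dφⱼ(0) ≠ 0`, and a radius `ε > 0`
such that every parameter `c` with `‖c‖ < ε` off all the walls (`φⱼ c ≠ 0`) is `Q`-good. Then `Q` is robustly
escapable at `d`: the direction set `⋂ⱼ ({φⱼ 0 ≠ 0} ∪ {v | dφⱼ(0) v ≠ 0})` is a finite intersection of open dense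
sets (complements of proper closed hyperplanes), and along each of its directions every wall is escaped for small
`t ≠ 0` (continuity at `0`, resp. non-zero derivative of `t ↦ φⱼ (t • v)` at `0`), below the least of finitely many
radii and below `ε / (‖v‖ + 1)`. This is the shape in which the model theorems deliver the third law / threshold
structure (Angelopoulos–Kehle–Unger: the asymptotically extremal set is a `C¹` hypersurface and the final parameter
ratio a `C¹` submersion, spherically symmetric Einstein–Maxwell–scalar field near Reissner–Nordström; Kehle–Unger
arXiv:2402.10190), hence the intended proof route of `stub_extremalChartFreeRobust`. Same argument as
`Theorems.RobustClausewiseGenericity.robustlyEscapable_of_walls` (Christodoulou 1999, p. A24), restated DEF-FREE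
so as not to depend on that module's import cone. -/
theorem stub_robustOfWalls :
    ∀ (X : Type) [TopologicalSpace X] [ChartedSpace E3 X] [IsManifold (𝓡 3) ∞ X] [T2Space X]
    [SecondCountableTopology X] [ConnectedSpace X] (d : InitialDataSet (𝓡 3) X) (Q : InitialDataSet
    (𝓡 3) X → Prop), (∀ (m : ℕ) (G : EuclideanSpace ℝ (Fin m) → InitialDataSet (𝓡 3) X),
    (InitialDataSet.IsSmoothDataFamily m G ∧ G 0 = d ∧ (∀ c, G c ∈ admissibleVacuumData X) ∧ ∃ K :
    Set X, IsCompact K ∧ ∀ c, ∀ x ∉ K, (G c).h.inner x = d.h.inner x ∧ (G c).k x = d.k x) → ∃ (n :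
    ℕ) (G₁ : EuclideanSpace ℝ (Fin n) → InitialDataSet (𝓡 3) X) (L : EuclideanSpace ℝ (Fin m) →ₗ[ℝ]
    EuclideanSpace ℝ (Fin n)), Function.Injective L ∧ (InitialDataSet.IsSmoothDataFamily n G₁ ∧ G₁ 0
    = d ∧ (∀ c, G₁ c ∈ admissibleVacuumData X) ∧ ∃ K : Set X, IsCompact K ∧ ∀ c, ∀ x ∉ K, (G₁
    c).h.inner x = d.h.inner x ∧ (G₁ c).k x = d.k x) ∧ (∀ c, G₁ (L c) = G c) ∧ ∀ (p : ℕ) (G₂ :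
    EuclideanSpace ℝ (Fin p) → InitialDataSet (𝓡 3) X) (L' : EuclideanSpace ℝ (Fin n) →ₗ[ℝ]
    EuclideanSpace ℝ (Fin p)), Function.Injective L' → (InitialDataSet.IsSmoothDataFamily p G₂ ∧ G₂
    0 = d ∧ (∀ c, G₂ c ∈ admissibleVacuumData X) ∧ ∃ K : Set X, IsCompact K ∧ ∀ c, ∀ x ∉ K, (G₂
    c).h.inner x = d.h.inner x ∧ (G₂ c).k x = d.k x) → (∀ c, G₂ (L' c) = G₁ c) → ∃ (J : ℕ) (φ : Fin
    J → EuclideanSpace ℝ (Fin p) → ℝ) (ε : ℝ), 0 < ε ∧ (∀ j, ContDiff ℝ 1 (φ j)) ∧ (∀ j, φ j 0 ≠ 0 ∨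
    fderiv ℝ (φ j) 0 ≠ 0) ∧ ∀ c : EuclideanSpace ℝ (Fin p), ‖c‖ < ε → (∀ j, φ j c ≠ 0) → Q (G₂ c)) →
    ∀ (m : ℕ) (G : EuclideanSpace ℝ (Fin m) → InitialDataSet (𝓡 3) X),
    (InitialDataSet.IsSmoothDataFamily m G ∧ G 0 = d ∧ (∀ c, G c ∈ admissibleVacuumData X) ∧ ∃ K :
    Set X, IsCompact K ∧ ∀ c, ∀ x ∉ K, (G c).h.inner x = d.h.inner x ∧ (G c).k x = d.k x) → ∃ (n :
    ℕ) (G₁ : EuclideanSpace ℝ (Fin n) → InitialDataSet (𝓡 3) X) (L : EuclideanSpace ℝ (Fin m) →ₗ[ℝ]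
    EuclideanSpace ℝ (Fin n)), Function.Injective L ∧ (InitialDataSet.IsSmoothDataFamily n G₁ ∧ G₁ 0
    = d ∧ (∀ c, G₁ c ∈ admissibleVacuumData X) ∧ ∃ K : Set X, IsCompact K ∧ ∀ c, ∀ x ∉ K, (G₁
    c).h.inner x = d.h.inner x ∧ (G₁ c).k x = d.k x) ∧ (∀ c, G₁ (L c) = G c) ∧ ∀ (p : ℕ) (G₂ :
    EuclideanSpace ℝ (Fin p) → InitialDataSet (𝓡 3) X) (L' : EuclideanSpace ℝ (Fin n) →ₗ[ℝ]
    EuclideanSpace ℝ (Fin p)), Function.Injective L' → (InitialDataSet.IsSmoothDataFamily p G₂ ∧ G₂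
    0 = d ∧ (∀ c, G₂ c ∈ admissibleVacuumData X) ∧ ∃ K : Set X, IsCompact K ∧ ∀ c, ∀ x ∉ K, (G₂
    c).h.inner x = d.h.inner x ∧ (G₂ c).k x = d.k x) → (∀ c, G₂ (L' c) = G₁ c) → ∃ U : Set
    (EuclideanSpace ℝ (Fin p)), IsOpen U ∧ Dense U ∧ ∀ v ∈ U, ∃ δ : ℝ, 0 < δ ∧ ∀ t : ℝ, t ≠ 0 → |t|
    < δ → Q (G₂ (t • v)) := by
  intro X _ _ _ _ _ _ d Q h m G hG
  obtain ⟨n, G₁, L, hL, hT, hGL, H⟩ := h m G hG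
  refine ⟨n, G₁, L, hL, hT, hGL, fun p G₂ L' hL' hT₂ hGL' => ?_⟩
  obtain ⟨J, φ, ε, hε, hφ, hnd, hgood⟩ := H p G₂ L' hL' hT₂ hGL'
  -- radial escape from one wall missing `0` or non-degenerate along `v`
  have hesc1 : ∀ j (v : EuclideanSpace ℝ (Fin p)), (φ j 0 ≠ 0 ∨ fderiv ℝ (φ j) 0 v ≠ 0) →
      ∃ δ : ℝ, 0 < δ ∧ ∀ t : ℝ, t ≠ 0 → |t| < δ → φ j (t • v) ≠ 0 := by
    intro j v hv
    have hev : ∀ᶠ t in 𝓝[≠] (0 : ℝ), φ j (t • v) ≠ 0 := by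
      rcases hv with h0 | hD
      · have hc : ContinuousAt (fun t : ℝ => φ j (t • v)) 0 :=
          ((hφ j).continuous.comp (continuous_id.smul continuous_const)).continuousAt
        have h00 : φ j ((0 : ℝ) • v) ≠ 0 := by rwa [zero_smul]
        exact (hc.eventually_ne h00).filter_mono nhdsWithin_le_nhds
      · have h1 : HasDerivAt (fun s : ℝ => s • v) ((1 : ℝ) • v) 0 := (hasDerivAt_id (0 : ℝ)).smul_const v
        rw [one_smul] at h1
        have h2 := (((hφ j).differentiable one_ne_zero) ((0 : ℝ) • v)).hasFDerivAt.comp_hasDerivAt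
          (0 : ℝ) h1
        rw [zero_smul] at h2
        exact h2.eventually_ne hD
    rw [eventually_nhdsWithin_iff, Metric.eventually_nhds_iff] at hev
    obtain ⟨δ, hδ, h'⟩ := hev
    exact ⟨δ, hδ, fun t ht htδ => h' (by simpa [Real.dist_eq] using htδ) ht⟩
  -- the complement of a proper closed hyperplane is dense
  have hdense : ∀ (f : EuclideanSpace ℝ (Fin p) →L[ℝ] ℝ) (w : EuclideanSpace ℝ (Fin p)), f w ≠ 0 →
      Dense {v : EuclideanSpace ℝ (Fin p) | f v ≠ 0} := by
    intro f w hw v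
    by_cases hv : f v = 0
    swap
    · exact subset_closure hv
    have htend : Tendsto (fun k : ℕ => v + (1 / ((k : ℝ) + 1)) • w) atTop (𝓝 v) := by
      have h1 : Tendsto (fun k : ℕ => (1 / ((k : ℝ) + 1)) • w) atTop (𝓝 ((0 : ℝ) • w)) :=
        tendsto_one_div_add_atTop_nhds_zero_nat.smul_const w
      rw [zero_smul] at h1
      simpa using tendsto_const_nhds.add h1
    refine mem_closure_of_tendsto htend (Eventually.of_forall fun k => ?_)
    show f (v + (1 / ((k : ℝ) + 1)) • w) ≠ 0
    rw [map_add, map_smul, hv, zero_add, smul_eq_mul]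
    exact mul_ne_zero (one_div_ne_zero (Nat.cast_add_one_ne_zero k)) hw
  -- the open dense direction set
  let U : Fin J → Set (EuclideanSpace ℝ (Fin p)) := fun j => {v | φ j 0 ≠ 0} ∪ {v | fderiv ℝ (φ j) 0 v ≠ 0}
  have hUo : ∀ j, IsOpen (U j) := fun j =>
    isOpen_const.union (isOpen_ne_fun (fderiv ℝ (φ j) 0).continuous continuous_const)
  have hUd : ∀ j, Dense (U j) := by
    intro j
    rcases hnd j with h0 | hD
    · exact dense_univ.mono fun v _ => Or.inl h0
    · obtain ⟨w, hw⟩ := DFunLike.ne_iff.1 hD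
      exact (hdense _ w (by simpa using hw)).mono fun v hv => Or.inr hv
  refine ⟨⋂ j, U j, isOpen_iInter_of_finite hUo, dense_iInter_of_isOpen hUo hUd, fun v hv => ?_⟩
  have hvj : ∀ j, φ j 0 ≠ 0 ∨ fderiv ℝ (φ j) 0 v ≠ 0 := fun j => Set.mem_iInter.1 hv j
  choose δ hδpos hδesc using fun j => hesc1 j v (hvj j)
  have hv1 : 0 < ‖v‖ + 1 := by positivity
  -- one radius escaping all walls
  obtain ⟨δ₀, hδ₀, hall⟩ : ∃ δ₀ : ℝ, 0 < δ₀ ∧ ∀ t : ℝ, t ≠ 0 → |t| < δ₀ → ∀ j, φ j (t • v) ≠ 0 := by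
    by_cases hJ : J = 0
    · subst hJ
      exact ⟨1, one_pos, fun t _ _ j => j.elim0⟩
    · haveI : Nonempty (Fin J) := ⟨⟨0, Nat.pos_of_ne_zero hJ⟩⟩
      obtain ⟨j₀, hj₀⟩ := Finite.exists_min δ
      exact ⟨δ j₀, hδpos j₀, fun t ht htδ j => hδesc j t ht (htδ.trans_le (hj₀ j))⟩
  refine ⟨min δ₀ (ε / (‖v‖ + 1)), lt_min hδ₀ (div_pos hε hv1), fun t ht htδ => ?_⟩
  refine hgood (t • v) ?_ (hall t ht (htδ.trans_le (min_le_left _ _)))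
  have htε : |t| < ε / (‖v‖ + 1) := htδ.trans_le (min_le_right _ _)
  have h1 : |t| * (‖v‖ + 1) < ε := (lt_div_iff₀ hv1).1 htε
  calc ‖t • v‖ = |t| * ‖v‖ := by rw [norm_smul, Real.norm_eq_abs]
    _ ≤ |t| * (‖v‖ + 1) := mul_le_mul_of_nonneg_left (by linarith) (abs_nonneg t)
    _ < ε := h1

end Summit.FinalStateConjecture.FinalStateConjecture.Theorems.PhotonSphereChannels.TameCensorshipUnwind

end
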